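import Summits.BirchSwinnertonDyer.BirchSwinnertonDyer.Theorems.ResidualThetaTransportAtTwoSignedMuVanishingAtTwoPlusOldClassResidual
import Summits.BirchSwinnertonDyer.BirchSwinnertonDyer.Theorems.ResidualThetaTransportAtTwoSignedMuVanishingAtTwoPlusFlatParity
import HarnessLib

/-!
# Route `ResidualThetaTransportAtTwo`, crux Kμ⁺ `SignedMuVanishingAtTwoPlus` (stmt-BirchSwinnertonDyer-20689),
# line `birth`, stub `stub_flatMuZeroAtTwo`: the plus-symbol congruence (C) of the old-class descent FROM
# mod-2 multiplicity one — FLAT at `(W, f)` from {uniqueness of the plus mod-2 eigencharacter, an old family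
# of a congruent newform `g` of a divisor level, one odd doubled plus symbol of `g`}

Cell `bsd-wall`, width seat `bsd-wall-rtt-p4-w2` (g3). THEOREMS ONLY (no `def`, no named fact, no `sorry`); helper
`--supports` the crux. Sequel of `…OldClassFlat` (old-class descent from the congruence (C)) and of the transport lemma
`…OldClassTransport`. BSD is not proved by this; every hypothesis is a hypothesis.

## What is proved
`…OldClassFlat.flatAtTwo_of_plusSymbol_congruence` takes the mod-2 congruence (C) of doubled plus symbols
`2([b/4^k]⁺_f − [0]⁺_f) ≡ ∑_{t∈S} 2([tb/4^k]⁺_g − [0]⁺_g)` as a hypothesis. Here (C) is DERIVED (`plusSymbol_congruence_of_multOne`)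
from the three ingredients named in the crux workfile `CuspSpanIhara.md` §3.3:
* (MO⁺) — UNIQUENESS OF THE PLUS MOD-2 EIGENCHARACTER of `f` at level `N` (inline hypothesis `hMO`): any two non-zero maps
  `χ : Γ₀(N) → ZMod 2` that are additive, factor through the period homology, are EVEN under `γ ↦ εγε`
  (`χ γ' = χ γ` when `γ', γ` have the same `(0,0)` entry and opposite `(1,0)` entries) and are Hecke eigencharacters with the
  eigenvalues `a_p(f) mod 2` (`χ σ = ā_p χ γ` whenever `{∞,σ∞} = T_p^∨{∞,γ∞}`), coincide. This is the COSOCLE form of mod-2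
  multiplicity one `dim_{𝔽₂} J₀(N)[𝔪_f] = 2` — the tree's named fact `buzzard2000_multiplicityOne_gamma0`
  (`Literature/…/ModularJacobianModTwoMultiplicityOne.lean`, Buzzard 2000 Prop. 2.4, applicable to the habitat because `W[2]`
  is ramified at `2`), transported to characters by the Hecke-hermitian perfect intersection pairing on `H₁(X₀(N); 𝔽₂)` and cut
  to the plus line by complex conjugation (= a transposition on `J₀(N)[𝔪] ≅ W[2]` since `Δ_W < 0`). That dictionary is NOT typed
  here: (MO⁺) stays an explicit hypothesis.
* an OLD FAMILY of the congruent newform `g` (level `N₀`, `a₂(g)` even): group homomorphisms `δ_t : Γ₀(N) → Γ₀(N₀)` (`t ∈ S`)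
  with `δ_t γ = (a, tb; c/t, d)` entrywise (the tree's `Gamma0.degeneracyConj N₀ N t`) and a cusp form `H` of level `N` with
  `{∞, γ∞}_H = ∑_t {∞, δ_tγ ∞}_g` (the tree's `∑_t degeneracyMap0 N₀ N t 2 g`, `cuspSymbol_degeneracyMap0`), which is a
  `T_p`-eigenform with eigenvalue `a_p(g)` for `p ∤ N` (`heckeT_degeneracyMap0_of_isNewform0`) and whose doubled real periods are
  Hecke eigen mod 2 with eigenvalue `a_p(f)` at the primes `p ∣ N` (hypothesis `hbad`: the `U_p`-bookkeeping of old forms, a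
  q-expansion identity per bad prime), and the congruence `a_p(f) ≡ a_p(g) (mod 2)` for `p ∤ N`;
* the residual certificate: one odd `2([b/4^k]⁺_g − [0]⁺_g)`, `k ≥ 1`, `b` odd.
THEN (`exists_odd_of_multOne`) some `2([b'/4^{k'}]⁺_f − [0]⁺_f)` is odd, and (`flatAtTwo_of_multOne`) `2 ∤ L♭` for every Pollack
pair of the habitat newform at `2`. Proof: the mod-2 characters `χ_f = (2 re{∞,γ∞}_f/Ω⁺_f) mod 2` and
`χ_H = (2 re{∞,γ∞}_H/Ω⁺_g) mod 2 = ∑_t χ_g ∘ δ_t` both satisfy the four conditions; `χ_f ≠ 0`; if `χ_H = 0` the transport lemma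
contradicts the residual certificate (`no_odd_of_sum_even`); otherwise (MO⁺) gives `χ_f = χ_H`, which at `γ = (·, b; ·, 4^k)`
is (C), and `…OldClassFlat` concludes.

References: K. Buzzard, Math. Res. Lett. 7 (2000) Prop. 2.4 [Buzzard2000]; M. Emerton, R. Pollack, T. Weston, Invent. Math.
163 (2006) §4.4 [EmertonPollackWeston2006]; B. Mazur, J. Tate, J. Teitelbaum, Invent. Math. 84 (1986) §I.4, §I.8
[MazurTateTeitelbaum1986Invent]; J. E. Cremona, *Algorithms for modular elliptic curves* (1997) §2.4, §2.6, §2.8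
[CremonaAlgorithms1997]; R. Pollack, Duke Math. J. 118 (2003) Conj. 6.3, Prop. 6.18 [Pollack2003].
-/

set_option autoImplicit false
set_option linter.dupNamespace false

noncomputable section

open scoped Classical MatrixGroups ModularForm

open CongruenceSubgroup WeierstrassCurve Literature.NumberTheory.EllipticCurves
  Literature.NumberTheory.EllipticCurves.ModularForms Literature.NumberTheory.EllipticCurves.Rank1Residual
  Literature.NumberTheory.IwasawaTheory Summit.BirchSwinnertonDyer.Rank1Residual.Supersingular
  Summit.BirchSwinnertonDyer.BirchSwinnertonDyer.Theses.ResidualThetaTransportAtTwo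

namespace Summit.BirchSwinnertonDyer.BirchSwinnertonDyer.Theorems.SignedMuAtTwo

/-! ## §2. (C) from mod-2 multiplicity one and an old family -/

section MultOne

variable {N : ℕ} [NeZero N] (f : CuspForm (Gamma0 N) 2) {N₀ : ℕ} [NeZero N₀] (g : CuspForm (Gamma0 N₀) 2)

/-- **An odd doubled plus symbol of `f` from MOD-2 MULTIPLICITY ONE, an old family of a congruent newform, and a residual
certificate.** Data: `f` a normalised newform of ODD level `N` with rational coefficients and Hecke eigenvalues
`A p = a_p(f) ∈ ℤ`; `g` likewise of odd level `N₀` with eigenvalues `B p`, `B 2` EVEN, and `A p ≡ B p (mod 2)` for `p ∤ N`;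
`S ≠ ∅` finite odd; homomorphisms `δ_t : Γ₀(N) → Γ₀(N₀)` (`t ∈ S`) with entries `(δ_t γ)₀₀ = γ₀₀`, `(δ_t γ)₀₁ = t γ₀₁`,
`(δ_t γ)₁₀ = γ₁₀ / t` with `t ∣ γ₁₀`, and `(δ_t γ)₁₁ = γ₁₁` (the tree's `Gamma0.degeneracyConj N₀ N t`, `N₀ t ∣ N`); a cusp form `H` of level `N` with
`{∞, γ∞}_H = ∑_t {∞, (δ_tγ)∞}_g`, `T_p H = B p · H` for `p ∤ N`, and mod-2 `U_p`-bookkeeping at `p ∣ N` (`hbad`: the doubled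
real periods `2 re{∞,·∞}_H/Ω⁺_g` are eigen mod 2 with eigenvalue `A p`). HYPOTHESIS (MO⁺) `hMO`: any two non-zero additive
maps `Γ₀(N) → ZMod 2` through the period homology, even under `ε`-conjugation and Hecke-eigen with eigenvalues `A p mod 2`
(all primes `p`), coincide — the cosocle/character form of mod-2 multiplicity one (`buzzard2000_multiplicityOne_gamma0`)
together with the complex-conjugation cut; NOT discharged here. CONCLUSION: one odd `2([b/4^k]⁺_g − [0]⁺_g)` (`k ≥ 1`, `b`
odd) gives one odd `2([b'/4^{k'}]⁺_f − [0]⁺_f)`. [cite: Buzzard2000, Prop. 2.4] [cite: CremonaAlgorithms1997, §2.4, §2.6, §2.8]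
[cite: EmertonPollackWeston2006, §4.4] -/
theorem exists_odd_of_multOne (hf : IsNewform0 f) (hQ : coeffField f = ⊥) (h2N : ¬ 2 ∣ N)
    (A : ℕ → ℤ) (hA : ∀ p : ℕ, p.Prime → cuspCoeff f p = (A p : ℂ))
    (hMO : ∀ χ₁ χ₂ : Gamma0 N → ZMod 2,
      (∀ γ γ' : Gamma0 N, χ₁ (γ * γ') = χ₁ γ + χ₁ γ') →
      (∀ γ γ' : Gamma0 N, periodFunctional N γ = periodFunctional N γ' → χ₁ γ = χ₁ γ') →
      (∀ γ γ' : Gamma0 N, (γ' : SL(2, ℤ)) 0 0 = (γ : SL(2, ℤ)) 0 0 →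
        (γ' : SL(2, ℤ)) 1 0 = -((γ : SL(2, ℤ)) 1 0) → χ₁ γ' = χ₁ γ) →
      (∀ (p : ℕ) (hp : p.Prime) (γ σ : Gamma0 N),
        periodFunctional N σ = (haveI : NeZero p := ⟨hp.ne_zero⟩; heckeT (Gamma0 N) 2 p).dualMap (periodFunctional N γ) →
        χ₁ σ = ((A p : ℤ) : ZMod 2) * χ₁ γ) →
      (∀ γ γ' : Gamma0 N, χ₂ (γ * γ') = χ₂ γ + χ₂ γ') →
      (∀ γ γ' : Gamma0 N, periodFunctional N γ = periodFunctional N γ' → χ₂ γ = χ₂ γ') →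
      (∀ γ γ' : Gamma0 N, (γ' : SL(2, ℤ)) 0 0 = (γ : SL(2, ℤ)) 0 0 →
        (γ' : SL(2, ℤ)) 1 0 = -((γ : SL(2, ℤ)) 1 0) → χ₂ γ' = χ₂ γ) →
      (∀ (p : ℕ) (hp : p.Prime) (γ σ : Gamma0 N),
        periodFunctional N σ = (haveI : NeZero p := ⟨hp.ne_zero⟩; heckeT (Gamma0 N) 2 p).dualMap (periodFunctional N γ) →
        χ₂ σ = ((A p : ℤ) : ZMod 2) * χ₂ γ) →
      (∃ γ, χ₁ γ ≠ 0) → (∃ γ, χ₂ γ ≠ 0) → ∀ γ, χ₁ γ = χ₂ γ)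
    (hg : IsNewform0 g) (hQg : coeffField g = ⊥) (h2N₀ : ¬ 2 ∣ N₀)
    (B : ℕ → ℤ) (hB : ∀ p : ℕ, p.Prime → cuspCoeff g p = (B p : ℂ)) (haev : Even (B 2))
    (hcongr : ∀ p : ℕ, p.Prime → ¬ p ∣ N → ((A p : ℤ) : ZMod 2) = ((B p : ℤ) : ZMod 2))
    (S : Finset ℕ) (hS : S.Nonempty) (hodd : ∀ t ∈ S, Odd t)
    (δ : ℕ → (Gamma0 N →* Gamma0 N₀))
    (hδ00 : ∀ t ∈ S, ∀ γ : Gamma0 N, ((δ t γ : Gamma0 N₀) : SL(2, ℤ)) 0 0 = (γ : SL(2, ℤ)) 0 0)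
    (hδ01 : ∀ t ∈ S, ∀ γ : Gamma0 N, ((δ t γ : Gamma0 N₀) : SL(2, ℤ)) 0 1 = (t : ℤ) * (γ : SL(2, ℤ)) 0 1)
    (hδ10 : ∀ t ∈ S, ∀ γ : Gamma0 N, ((δ t γ : Gamma0 N₀) : SL(2, ℤ)) 1 0 = (γ : SL(2, ℤ)) 1 0 / t)
    (hδ11 : ∀ t ∈ S, ∀ γ : Gamma0 N, ((δ t γ : Gamma0 N₀) : SL(2, ℤ)) 1 1 = (γ : SL(2, ℤ)) 1 1)
    (hδdvd : ∀ t ∈ S, ∀ γ : Gamma0 N, (t : ℤ) ∣ (γ : SL(2, ℤ)) 1 0)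
    (H : CuspForm (Gamma0 N) 2) (hH : ∀ γ : Gamma0 N, cuspSymbol H γ = ∑ t ∈ S, cuspSymbol g (δ t γ))
    (hgood : ∀ (p : ℕ) (hp : p.Prime), ¬ p ∣ N →
      (haveI : NeZero p := ⟨hp.ne_zero⟩; heckeT (Gamma0 N) 2 p) H = ((B p : ℤ) : ℂ) • H)
    (hbad : ∀ (p : ℕ) (hp : p.Prime), p ∣ N → ∀ γ σ : Gamma0 N,
      periodFunctional N σ = (haveI : NeZero p := ⟨hp.ne_zero⟩; heckeT (Gamma0 N) 2 p).dualMap (periodFunctional N γ) →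
      ∀ mσ mγ : ℤ, (cuspSymbol H σ).re = mσ * (plusPeriod g / 2) → (cuspSymbol H γ).re = mγ * (plusPeriod g / 2) →
        (mσ : ZMod 2) = ((A p : ℤ) : ZMod 2) * (mγ : ZMod 2))
    (hres : ∃ k : ℕ, 1 ≤ k ∧ ∃ b : ℤ, Odd b ∧ ∃ m : ℤ, Odd m ∧
      ratPlusSymbol g ((b : ℚ) / 4 ^ k) = ratPlusSymbol g 0 + (m : ℚ) / 2) :
    ∃ k : ℕ, 1 ≤ k ∧ ∃ b : ℤ, Odd b ∧ ∃ m : ℤ, Odd m ∧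
      ratPlusSymbol f ((b : ℚ) / 4 ^ k) = ratPlusSymbol f 0 + (m : ℚ) / 2 := by
  have hrealf : ∀ n, (cuspCoeff f n).im = 0 := cuspCoeff_im_eq_zero_of_coeffField_eq_bot hQ
  have hrealg : ∀ n, (cuspCoeff g n).im = 0 := cuspCoeff_im_eq_zero_of_coeffField_eq_bot hQg
  have hΩf : plusPeriod f ≠ 0 := (IsNewform0.plusPeriod_pos_holds hf hQ).ne'
  have hΩg : plusPeriod g ≠ 0 := (IsNewform0.plusPeriod_pos_holds hg hQg).ne'
  have h20 : ∀ r : ℤ, ((r + r : ℤ) : ZMod 2) = 0 := by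
    intro r; push_cast; rw [← two_mul]; exact mul_eq_zero_of_left (by decide) _
  -- the doubled plus characters
  choose mf hmf using exists_int_re_cuspSymbol_eq f hΩf
  choose mg hmg using exists_int_re_cuspSymbol_eq g hΩg
  -- χ_f
  have hf_add : ∀ γ γ' : Gamma0 N, mf (γ * γ') = mf γ + mf γ' := by
    intro γ γ'
    apply int_eq_of_mul_plusPeriod_half_eq f hΩf
    have h := congrArg Complex.re (cuspSymbol_mul_holds f γ γ')
    rw [Complex.add_re, hmf, hmf, hmf] at h
    rw [h]; push_cast; ring
  have hf_per : ∀ γ γ' : Gamma0 N, periodFunctional N γ = periodFunctional N γ' → mf γ = mf γ' := by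
    intro γ γ' h
    apply int_eq_of_mul_plusPeriod_half_eq f hΩf
    rw [← hmf, ← hmf, ← periodFunctional_apply N γ f, ← periodFunctional_apply N γ' f, h]
  have hf_plus : ∀ γ γ' : Gamma0 N, (γ' : SL(2, ℤ)) 0 0 = (γ : SL(2, ℤ)) 0 0 →
      (γ' : SL(2, ℤ)) 1 0 = -((γ : SL(2, ℤ)) 1 0) → mf γ' = mf γ := by
    intro γ γ' h00 h10
    apply int_eq_of_mul_plusPeriod_half_eq f hΩf
    rw [← hmf, ← hmf, cuspSymbol_eq_conj_of_apply f hrealf γ γ' h00 h10, Complex.conj_re]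
  have hf_hecke : ∀ (p : ℕ) (hp : p.Prime) (γ σ : Gamma0 N),
      periodFunctional N σ = (haveI : NeZero p := ⟨hp.ne_zero⟩; heckeT (Gamma0 N) 2 p).dualMap (periodFunctional N γ) →
      mf σ = A p * mf γ := by
    intro p hp γ σ hσ
    haveI : NeZero p := ⟨hp.ne_zero⟩
    have hT : heckeT (Gamma0 N) 2 p f = ((A p : ℤ) : ℂ) • f := by
      rw [IsNewform0.heckeT_eq_coeff_smul hf hp]
      change cuspCoeff f p • f = _
      rw [hA p hp]
    have h1 : cuspSymbol f σ = ((A p : ℤ) : ℂ) * cuspSymbol f γ := by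
      have := congrArg (fun φ : Module.Dual ℂ (CuspForm (Gamma0 N) 2) ↦ φ f) hσ
      simp only [periodFunctional_apply, LinearMap.dualMap_apply] at this
      rw [this, hT, cuspSymbol_smul]
    apply int_eq_of_mul_plusPeriod_half_eq f hΩf
    have := congrArg Complex.re h1
    rw [show (((A p : ℤ) : ℂ)) = (((A p : ℤ) : ℝ) : ℂ) by norm_cast, Complex.re_ofReal_mul, hmf, hmf] at this
    rw [this]; push_cast; ring
  -- χ_H (with respect to Ω⁺_g)
  set mH : Gamma0 N → ℤ := fun γ ↦ ∑ t ∈ S, mg (δ t γ) with hmHdef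
  have hmH : ∀ γ : Gamma0 N, (cuspSymbol H γ).re = mH γ * (plusPeriod g / 2) := by
    intro γ
    rw [hH γ, Complex.re_sum, hmHdef]
    simp only
    push_cast
    rw [Finset.sum_mul]
    exact Finset.sum_congr rfl fun t _ ↦ hmg _
  have hH_add : ∀ γ γ' : Gamma0 N, mH (γ * γ') = mH γ + mH γ' := by
    intro γ γ'
    simp only [hmHdef, map_mul, ← Finset.sum_add_distrib]
    refine Finset.sum_congr rfl fun t _ ↦ ?_
    apply int_eq_of_mul_plusPeriod_half_eq g hΩg
    have h := congrArg Complex.re (cuspSymbol_mul_holds g (δ t γ) (δ t γ'))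
    rw [Complex.add_re, hmg, hmg, hmg] at h
    rw [h]; push_cast; ring
  have hH_per : ∀ γ γ' : Gamma0 N, periodFunctional N γ = periodFunctional N γ' → mH γ = mH γ' := by
    intro γ γ' h
    apply int_eq_of_mul_plusPeriod_half_eq g hΩg
    rw [← hmH, ← hmH, ← periodFunctional_apply N γ H, ← periodFunctional_apply N γ' H, h]
  have hH_plus : ∀ γ γ' : Gamma0 N, (γ' : SL(2, ℤ)) 0 0 = (γ : SL(2, ℤ)) 0 0 →
      (γ' : SL(2, ℤ)) 1 0 = -((γ : SL(2, ℤ)) 1 0) → mH γ' = mH γ := by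
    intro γ γ' h00 h10
    simp only [hmHdef]
    refine Finset.sum_congr rfl fun t ht ↦ ?_
    apply int_eq_of_mul_plusPeriod_half_eq g hΩg
    have hd00 : ((δ t γ' : Gamma0 N₀) : SL(2, ℤ)) 0 0 = ((δ t γ : Gamma0 N₀) : SL(2, ℤ)) 0 0 := by
      rw [hδ00 t ht, hδ00 t ht, h00]
    have hd10 : ((δ t γ' : Gamma0 N₀) : SL(2, ℤ)) 1 0 = -(((δ t γ : Gamma0 N₀) : SL(2, ℤ)) 1 0) := by
      rw [hδ10 t ht, hδ10 t ht, h10, Int.neg_ediv_of_dvd (hδdvd t ht γ)]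
    rw [← hmg, ← hmg, cuspSymbol_eq_conj_of_apply g hrealg _ _ hd00 hd10, Complex.conj_re]
  have hH_hecke : ∀ (p : ℕ) (hp : p.Prime) (γ σ : Gamma0 N),
      periodFunctional N σ = (haveI : NeZero p := ⟨hp.ne_zero⟩; heckeT (Gamma0 N) 2 p).dualMap (periodFunctional N γ) →
      (mH σ : ZMod 2) = ((A p : ℤ) : ZMod 2) * (mH γ : ZMod 2) := by
    intro p hp γ σ hσ
    haveI : NeZero p := ⟨hp.ne_zero⟩
    by_cases hpN : p ∣ N
    · exact hbad p hp hpN γ σ hσ (mH σ) (mH γ) (hmH σ) (hmH γ)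
    · have h1 : cuspSymbol H σ = ((B p : ℤ) : ℂ) * cuspSymbol H γ := by
        have := congrArg (fun φ : Module.Dual ℂ (CuspForm (Gamma0 N) 2) ↦ φ H) hσ
        simp only [periodFunctional_apply, LinearMap.dualMap_apply] at this
        rw [this, hgood p hp hpN, cuspSymbol_smul]
      have h2 : mH σ = B p * mH γ := by
        apply int_eq_of_mul_plusPeriod_half_eq g hΩg
        have := congrArg Complex.re h1
        rw [show (((B p : ℤ) : ℂ)) = (((B p : ℤ) : ℝ) : ℂ) by norm_cast, Complex.re_ofReal_mul, hmH, hmH] at this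
        rw [this]; push_cast; ring
      rw [h2, hcongr p hp hpN]; push_cast; ring
  -- the values at `γ = (·, b; ·, 4^k)`
  have hNodd : Odd N := Nat.odd_iff.mpr (Nat.two_dvd_ne_zero.mp h2N)
  have hval : ∀ k : ℕ, 1 ≤ k → ∀ b : ℤ, Odd b → ∃ γ : Gamma0 N,
      2 * (ratPlusSymbol f ((b : ℚ) / 4 ^ k) - ratPlusSymbol f 0) = mf γ ∧
      ∑ t ∈ S, 2 * (ratPlusSymbol g ((((t : ℤ) * b : ℤ) : ℚ) / 4 ^ k) - ratPlusSymbol g 0) = mH γ := by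
    intro k _ b hb
    obtain ⟨γ, hγb, hγd⟩ := FlatParityAtTwo.exists_gamma0_entries hNodd hb (2 * k)
    have h4 : ((2 : ℤ) ^ (2 * k)) = 4 ^ k := by rw [pow_mul]; norm_num
    rw [h4] at hγd
    have hd0 : (γ : SL(2, ℤ)) 1 1 ≠ 0 := by rw [hγd]; positivity
    refine ⟨γ, ?_, ?_⟩
    · have h := ratPlusSymbol_apply_div_eq_add_half f hf hQ γ hd0 (hmf γ)
      rw [hγb, hγd] at h
      push_cast at h
      rw [h]; ring
    · simp only [hmHdef]
      push_cast
      refine Finset.sum_congr rfl fun t ht ↦ ?_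
      have hd0' : ((δ t γ : Gamma0 N₀) : SL(2, ℤ)) 1 1 ≠ 0 := by rw [hδ11 t ht]; exact hd0
      have h := ratPlusSymbol_apply_div_eq_add_half g hg hQg (δ t γ) hd0' (hmg (δ t γ))
      rw [hδ01 t ht, hδ11 t ht, hγb, hγd] at h
      push_cast at h ⊢
      rw [h]; ring
  -- case distinction on `χ_H`
  by_cases hHz : ∀ γ : Gamma0 N, (mH γ : ZMod 2) = 0
  · exfalso
    obtain ⟨k, hk, b, hb, m, hmo, hm⟩ := hres
    refine no_odd_of_sum_even g hg hQg h2N₀ (hB 2 Nat.prime_two) haev S hS hodd ?_ hk hb hmo hm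
    intro k' hk' b' hb'
    obtain ⟨γ, -, hγ⟩ := hval k' hk' b' hb'
    have h2 : (2 : ℤ) ∣ mH γ := (ZMod.intCast_zmod_eq_zero_iff_dvd _ 2).mp (hHz γ)
    obtain ⟨z, hz⟩ := h2
    exact ⟨z, by rw [hγ, hz]; push_cast; ring⟩
  · push Not at hHz
    obtain ⟨γ₁, hγ₁⟩ := hHz
    obtain ⟨γ₀, hγ₀⟩ := exists_re_cuspSymbol_eq_plusPeriod_half f hΩf
    have hmf1 : mf γ₀ = 1 := int_eq_of_mul_plusPeriod_half_eq f hΩf (by rw [← hmf, hγ₀]; push_cast; ring)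
    have heq := hMO (fun γ ↦ (mf γ : ZMod 2)) (fun γ ↦ (mH γ : ZMod 2))
      (fun γ γ' ↦ by simp only [hf_add]; push_cast; rfl)
      (fun γ γ' h ↦ by simp only [hf_per γ γ' h])
      (fun γ γ' h00 h10 ↦ by simp only [hf_plus γ γ' h00 h10])
      (fun p hp γ σ h ↦ by simp only [hf_hecke p hp γ σ h]; push_cast; rfl)
      (fun γ γ' ↦ by simp only [hH_add]; push_cast; rfl)
      (fun γ γ' h ↦ by simp only [hH_per γ γ' h])
      (fun γ γ' h00 h10 ↦ by simp only [hH_plus γ γ' h00 h10])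
      hH_hecke
      ⟨γ₀, by rw [hmf1]; exact one_ne_zero⟩ ⟨γ₁, hγ₁⟩
    -- (C) and conclusion
    refine exists_odd_of_plusSymbol_congruence f g hQ h2N hg hQg h2N₀ (hB 2 Nat.prime_two) haev S hS hodd ?_ hres
    intro k hk b hb
    obtain ⟨γ, hγf, hγH⟩ := hval k hk b hb
    have h : ((mf γ : ℤ) : ZMod 2) = ((mH γ : ℤ) : ZMod 2) := heq γ
    rw [ZMod.intCast_eq_intCast_iff_dvd_sub] at h
    obtain ⟨z, hz⟩ := h
    refine ⟨-z, ?_⟩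
    rw [hγf, hγH]
    have : (mf γ : ℚ) - mH γ = -(mH γ - mf γ : ℤ) := by push_cast; ring
    rw [this, hz]; push_cast; ring

end MultOne

/-! ## §3. The habitat⁺: FLAT at `(W, f)` from mod-2 multiplicity one, an old family and a residual certificate -/

section Habitat

variable {W : WeierstrassCurve ℚ} [W.IsElliptic] [W.IsGloballyMinimal]

/-- **FLAT at `(W, f)` from MOD-2 MULTIPLICITY ONE (cosocle-plus form, hypothesis `hMO`), an OLD FAMILY of a congruent
rational newform `g` of a level `N₀` (data `δ`, `H`, `hgood`, `hbad`, `hcongr` as in `exists_odd_of_multOne`, with the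
eigenvalues of the habitat newform `f` being `A p = a_p(W)`), and ONE odd doubled plus symbol of `g`.** For `W/ℚ` good
supersingular at `2` with `a₂(W) = 0`: `2 ∤ L♭` for every Pollack pair `(L♯, L♭)` of `f` at `2` (μ(L♭_f) = 0). Chain:
`exists_odd_of_multOne` → `norm_ratPlusSymbol_eq_two_of_eq_add_half` → `exists_ratPlusSymbol_pow_cyclotomicGenerator_eq` →
`flatAtTwo_of_two_le_norm_ratPlusSymbol`. BSD is not proved by this; `hMO`, `hbad`, `hcongr` and the residual certificate are
hypotheses (`hMO` is Buzzard 2000 Prop. 2.4 = `buzzard2000_multiplicityOne_gamma0` read through the intersection pairing and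
complex conjugation — a dictionary not typed here). [cite: Buzzard2000, Prop. 2.4] [cite: Pollack2003, Conj. 6.3 and Prop. 6.18]
[cite: EmertonPollackWeston2006, §4.4] -/
theorem flatAtTwo_of_multOne [NeZero (W.conductorNorm ℤ)] {f : CuspForm (Gamma0 (W.conductorNorm ℤ)) 2}
    (hf : IsNewformOf W f) (hss : GoodSS W 2) (ha : W.frobeniusTrace 2 = 0)
    (A : ℕ → ℤ) (hA : ∀ p : ℕ, p.Prime → cuspCoeff f p = (A p : ℂ))
    (hMO : ∀ χ₁ χ₂ : Gamma0 (W.conductorNorm ℤ) → ZMod 2,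
      (∀ γ γ' : Gamma0 (W.conductorNorm ℤ), χ₁ (γ * γ') = χ₁ γ + χ₁ γ') →
      (∀ γ γ' : Gamma0 (W.conductorNorm ℤ),
        periodFunctional (W.conductorNorm ℤ) γ = periodFunctional (W.conductorNorm ℤ) γ' → χ₁ γ = χ₁ γ') →
      (∀ γ γ' : Gamma0 (W.conductorNorm ℤ), (γ' : SL(2, ℤ)) 0 0 = (γ : SL(2, ℤ)) 0 0 →
        (γ' : SL(2, ℤ)) 1 0 = -((γ : SL(2, ℤ)) 1 0) → χ₁ γ' = χ₁ γ) →
      (∀ (p : ℕ) (hp : p.Prime) (γ σ : Gamma0 (W.conductorNorm ℤ)),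
        periodFunctional (W.conductorNorm ℤ) σ =
          (haveI : NeZero p := ⟨hp.ne_zero⟩; heckeT (Gamma0 (W.conductorNorm ℤ)) 2 p).dualMap
            (periodFunctional (W.conductorNorm ℤ) γ) →
        χ₁ σ = ((A p : ℤ) : ZMod 2) * χ₁ γ) →
      (∀ γ γ' : Gamma0 (W.conductorNorm ℤ), χ₂ (γ * γ') = χ₂ γ + χ₂ γ') →
      (∀ γ γ' : Gamma0 (W.conductorNorm ℤ),
        periodFunctional (W.conductorNorm ℤ) γ = periodFunctional (W.conductorNorm ℤ) γ' → χ₂ γ = χ₂ γ') →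
      (∀ γ γ' : Gamma0 (W.conductorNorm ℤ), (γ' : SL(2, ℤ)) 0 0 = (γ : SL(2, ℤ)) 0 0 →
        (γ' : SL(2, ℤ)) 1 0 = -((γ : SL(2, ℤ)) 1 0) → χ₂ γ' = χ₂ γ) →
      (∀ (p : ℕ) (hp : p.Prime) (γ σ : Gamma0 (W.conductorNorm ℤ)),
        periodFunctional (W.conductorNorm ℤ) σ =
          (haveI : NeZero p := ⟨hp.ne_zero⟩; heckeT (Gamma0 (W.conductorNorm ℤ)) 2 p).dualMap
            (periodFunctional (W.conductorNorm ℤ) γ) →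
        χ₂ σ = ((A p : ℤ) : ZMod 2) * χ₂ γ) →
      (∃ γ, χ₁ γ ≠ 0) → (∃ γ, χ₂ γ ≠ 0) → ∀ γ, χ₁ γ = χ₂ γ)
    {N₀ : ℕ} [NeZero N₀] (g : CuspForm (Gamma0 N₀) 2) (hg : IsNewform0 g) (hQg : coeffField g = ⊥)
    (h2N₀ : ¬ 2 ∣ N₀) (B : ℕ → ℤ) (hB : ∀ p : ℕ, p.Prime → cuspCoeff g p = (B p : ℂ)) (haev : Even (B 2))
    (hcongr : ∀ p : ℕ, p.Prime → ¬ p ∣ W.conductorNorm ℤ → ((A p : ℤ) : ZMod 2) = ((B p : ℤ) : ZMod 2))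
    (S : Finset ℕ) (hS : S.Nonempty) (hodd : ∀ t ∈ S, Odd t)
    (δ : ℕ → (Gamma0 (W.conductorNorm ℤ) →* Gamma0 N₀))
    (hδ00 : ∀ t ∈ S, ∀ γ : Gamma0 (W.conductorNorm ℤ), ((δ t γ : Gamma0 N₀) : SL(2, ℤ)) 0 0 = (γ : SL(2, ℤ)) 0 0)
    (hδ01 : ∀ t ∈ S, ∀ γ : Gamma0 (W.conductorNorm ℤ),
      ((δ t γ : Gamma0 N₀) : SL(2, ℤ)) 0 1 = (t : ℤ) * (γ : SL(2, ℤ)) 0 1)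
    (hδ10 : ∀ t ∈ S, ∀ γ : Gamma0 (W.conductorNorm ℤ),
      ((δ t γ : Gamma0 N₀) : SL(2, ℤ)) 1 0 = (γ : SL(2, ℤ)) 1 0 / t)
    (hδ11 : ∀ t ∈ S, ∀ γ : Gamma0 (W.conductorNorm ℤ), ((δ t γ : Gamma0 N₀) : SL(2, ℤ)) 1 1 = (γ : SL(2, ℤ)) 1 1)
    (hδdvd : ∀ t ∈ S, ∀ γ : Gamma0 (W.conductorNorm ℤ), (t : ℤ) ∣ (γ : SL(2, ℤ)) 1 0)
    (H : CuspForm (Gamma0 (W.conductorNorm ℤ)) 2)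
    (hH : ∀ γ : Gamma0 (W.conductorNorm ℤ), cuspSymbol H γ = ∑ t ∈ S, cuspSymbol g (δ t γ))
    (hgood : ∀ (p : ℕ) (hp : p.Prime), ¬ p ∣ W.conductorNorm ℤ →
      (haveI : NeZero p := ⟨hp.ne_zero⟩; heckeT (Gamma0 (W.conductorNorm ℤ)) 2 p) H = ((B p : ℤ) : ℂ) • H)
    (hbad : ∀ (p : ℕ) (hp : p.Prime), p ∣ W.conductorNorm ℤ → ∀ γ σ : Gamma0 (W.conductorNorm ℤ),
      periodFunctional (W.conductorNorm ℤ) σ =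
        (haveI : NeZero p := ⟨hp.ne_zero⟩; heckeT (Gamma0 (W.conductorNorm ℤ)) 2 p).dualMap
          (periodFunctional (W.conductorNorm ℤ) γ) →
      ∀ mσ mγ : ℤ, (cuspSymbol H σ).re = mσ * (plusPeriod g / 2) → (cuspSymbol H γ).re = mγ * (plusPeriod g / 2) →
        (mσ : ZMod 2) = ((A p : ℤ) : ZMod 2) * (mγ : ZMod 2))
    (hres : ∃ k : ℕ, 1 ≤ k ∧ ∃ b : ℤ, Odd b ∧ ∃ m : ℤ, Odd m ∧
      ratPlusSymbol g ((b : ℚ) / 4 ^ k) = ratPlusSymbol g 0 + (m : ℚ) / 2) :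
    ∀ Lplus Lminus : IwasawaAlgebra 2, IsPollackPair f 2 Lplus Lminus → ¬ PowerSeries.C (2 : ℤ_[2]) ∣ Lminus := by
  have h2N : ¬ 2 ∣ W.conductorNorm ℤ := not_two_dvd_conductorNorm_of_goodSS hss
  have ha₂ : cuspCoeff f 2 = 0 := by
    rw [hf.2 2, W.LFunction_apply_prime_eq_frobeniusTrace 2 hss.1, ha]; simp
  obtain ⟨k, hk, b, hb, m, hmo, hmeq⟩ := exists_odd_of_multOne f g hf.1 hf.coeffField_eq_bot h2N A hA hMO hg hQg h2N₀
    B hB haev hcongr S hS hodd δ hδ00 hδ01 hδ10 hδ11 hδdvd H hH hgood hbad hres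
  have hnorm := norm_ratPlusSymbol_eq_two_of_eq_add_half f hf.1 hf.coeffField_eq_bot h2N ha₂ hmo hmeq
  have hd : ((4 : ℤ) ^ k).natAbs = 2 ^ ((2 * k - 2) + 2) := by
    rw [Int.natAbs_pow, show (4 : ℤ).natAbs = 2 ^ 2 by decide, ← pow_mul]
    congr 1; omega
  obtain ⟨s, hs⟩ := exists_ratPlusSymbol_pow_cyclotomicGenerator_eq f hb (2 * k - 2) hd
  have hcast : ((b : ℚ) / (((4 : ℤ) ^ k : ℤ) : ℚ)) = (b : ℚ) / 4 ^ k := by push_cast; rfl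
  rw [hcast] at hs
  refine flatAtTwo_of_two_le_norm_ratPlusSymbol (n := 2 * k - 2) ⟨k - 1, by omega⟩ (s := s) ?_
  rw [hs, hnorm]

end Habitat

end Summit.BirchSwinnertonDyer.BirchSwinnertonDyer.Theorems.SignedMuAtTwo

end
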